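import Literature.Analysis.FluidPDE.LerayHopf
import Literature.Analysis.FluidPDE.RieszPressureL3
import Literature.Analysis.FluidPDE.SuitableWeak
import Literature.Analysis.FunctionSpaces.WeakLp
import HarnessLib

/-!
# Barker 2024: higher integrability of `∇v` and the number of singular points at a first blow-up
# time under a weak-`L³` (Type-I) bound — along all times, resp. along a sequence of times only

Topic `Analysis/FluidPDE`. Source: T. Barker, *Higher integrability and the number of singular
points for the Navier–Stokes equations with a scale-invariant bound*, Proc. Amer. Math. Soc. Ser. B
11 (2024), doi:10.1090/bproc/193 = arXiv:2111.14776 [`Barker2024`]; read in the arXiv version (held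
text `paper:arxiv-2111.14776`), §1.1 "Statement of results" (pp. 2–3: Theorem 1, **Corollary 1**,
**Theorem 2**), §1.4 (Lorentz quasi-norm `‖g‖_{L^{p,∞}(Ω)} = sup_α α d_{g,Ω}(α)^{1/p}`) and
footnotes 3–4 (p. 2: "`M` sufficiently large means `M ≥ M₁` for a suitably chosen large universal
constant `M₁`"; "`(x₀,T*)` is a singular point of `v` if `v ∉ L^∞_{x,t}(B(x₀,r) × (T* − r², T*))` for
all sufficiently small `r > 0`"). One file for the paper's §1.1 (D-0064).

## The printed statements (unit viscosity, no force)

* **Corollary 1.** "There exists a universal constant `C^{(1)}_univ ∈ (0,∞)` such that the following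
  holds. Let `v` be a weak Leray–Hopf solution to the Navier–Stokes equations on `ℝ³ × (0,∞)` …
  Assume that `v` first blows up at `T*`, namely `v ∈ L^∞_loc([0,T*); L^∞(ℝ³))` and
  `lim_{t↑T*} ‖v(·,t)‖_{L^∞(ℝ³)} = ∞`. Assume there exists an `M` sufficiently large such that
  `‖v‖_{L^∞((0,T*); L^{3,∞}(ℝ³))} ≤ M`. Then … for all `t₂ ∈ (0,T*)` we have
  `∇v ∈ L^{2 + C^{(1)}_univ/M}(ℝ³ × (t₂,T*))`."
* **Theorem 2.** "There exists a universal constant `C^{(2)}_univ ∈ [1,∞)` such that the following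
  holds. Let `v` be a weak Leray–Hopf solution to the Navier–Stokes equations on `ℝ³ × (−1,∞)`.
  Assume that `v` first blows-up at `0`, namely `v ∈ L^∞_loc([−1,0); L^∞(ℝ³))` and
  `lim_{t↑0} ‖v(·,t)‖_{L^∞(ℝ³)} = ∞`. Let `M` be sufficiently large and assume that there exists an
  increasing sequence `s^{(n)} ∈ (−1,0)` with `s^{(n)} ↑ 0` such that `v` satisfies
  `sup_n ‖v(·,s^{(n)})‖_{L^{3,∞}(ℝ³)} = M < ∞`. Let `σ := {x : (x,0) is a singular point of v}`. Then
  the above assumptions imply that `σ` has at most `C^{(2)}_univ M^{20}` elements."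
  (§1.2.2: this improves Choe–Wolf–Yang 2019 / Seregin 2019 — finitely many singular points under
  the Type I bound `‖v‖_{L^∞(0,T*; L^{3,∞})} ≤ M` — and the count `exp(exp(M^{1024}))` of
  Barker–Prange 2021, Cor. 9 = the tree's `barkerPrange2021_typeI_card_singular_points`, to a bound
  along time slices only and polynomial in `M`.)

## Contents (named facts, D-0014)

* `barker2024_typeI_gradient_higher_integrability` — Corollary 1.
* `barker2024_card_singular_points_weakL3_slices` — Theorem 2.
* `barker2024_higher_integrability_weak_pressure` — Theorem 1 (appended 2026-08-26, second
  proposal of this file; see the addendum at the end of the module docstring).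

## Transcription notes (never stronger than print)

* *Class.* "Weak Leray–Hopf solution on `ℝ³ × (0,∞)`" (energy inequality (1.3) for all `t ≥ 0`) =
  the tree's `IsGlobalLerayHopf ν 0 u₀ u` (Leray–Hopf on `[0,T]` for every `T`, strict sense), as in
  `BarkerPrange2020_thm2`. "First blows up at `T*`" is transcribed by BOTH printed clauses:
  `v ∈ L^∞_loc([0,T*); L^∞)` as essential boundedness of `uncurry u` on `(0,T') × ℝ³` for every
  `T' < T*` (the slice `t = 0` is Lebesgue-null), and `lim_{t↑T*} ‖v(·,t)‖_{L^∞} = ∞` as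
  `Tendsto (t ↦ eLpNorm (u t) ∞ volume) (𝓝[<] T) (𝓝 ∞)`.
* *`L^{3,∞}` bounds* via `FunctionSpaces.eWeakLpPow (u t) 3 volume ≤ (ofReal M)³`
  (`‖g‖_{L^{3,∞}} = sup_α α d_g(α)^{1/3}`, §1.4). In Thm 2 the printed "`sup_n ‖v(·,s^{(n)})‖ = M < ∞`,
  `M` sufficiently large" is recorded as `sup_n ‖…‖ ≤ M` with `M ≥ M₁` (footnote 3); a sequence with
  a smaller supremum satisfies the bound with `M₁`, so nothing is lost and nothing is added.
  "Increasing sequence `s^{(n)} ↑ 0`" = `StrictMono s ∧ Tendsto s atTop (𝓝 T)` with `s n ∈ (0,T)`.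
* *Singular points at the blow-up time* (footnote 4) = essential unboundedness of `uncurry u` on every
  backward cylinder `parabolicCylinder r (T,x) = (T − r², T) × B_r(x)`, `0 < r`, `r² < T` (the
  convention of `BarkerPrange2020_thm2`, `barkerPrange2021_typeI_card_singular_points`); "at most
  `C M^{20}` elements" = membership of all of them in a `Finset` of real cardinality `≤ C M^{20}`.
* *`∇v ∈ L^q(ℝ³ × (t₂,T*))`* (Cor 1): some a.e.-in-time weak gradient `G` of the slices
  (`HasWeakGradient (u t) (G t)`, the Leray–Hopf convention; a.e. unique) has
  `∫_{t₂}^{T} ∫ |G|^q < ∞`, `|G|² = frobeniusNormSq G`, `q = 2 + C/M`.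
* *Viscosity, time origin, scaling.* Printed for `ν = 1` (on `(0,∞)`, resp. `(−1,∞)` with blow-up at
  `0`). Recorded on the tree's frame `[0,∞)`, blow-up time `T > 0`, for every `ν > 0`, through
  `w(y,s) = (λ/ν) u(λy, T + λ²s/ν)`, `λ = √(νT)` (a unit-viscosity global Leray–Hopf solution on
  `(−1,∞)` blowing up first at `0`; `‖w(s)‖_{L^{3,∞}} = ν⁻¹‖u(t)‖_{L^{3,∞}}`, so the bounds read
  `‖u(t)‖_{L^{3,∞}} ≤ νM`; singular points correspond under `x = λy`, so the count is unchanged;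
  finiteness of `∫∫ |∇w|^q` over `(σ,0) × ℝ³` is that of `∫∫ |∇u|^q` over the corresponding slab).
* Not here: Props 1–3 and the proofs (§§2–3).

## Addendum (second proposal): Theorem 1, the pressure form

* **Theorem 1** (printed). "There exists a universal constant `C^{(0)}_univ ∈ [1,∞)` such that the
  following holds. Let `v` be a weak Leray–Hopf solution to the Navier–Stokes equations on
  `ℝ³ × (0,∞)` and let `p` be the pressure associated to the solution `v`. Assume that `v` first
  blows up `T*` [the two clauses above]. Assume there exists an `M` sufficiently large such that
  `‖p‖_{L^∞((0,T*); L^{3/2,∞}(ℝ³))} ≤ M²`. Then … for all `t₁ ∈ (0,T*)` we have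
  `‖|v|^{q/2}‖_{L^∞((t₁,T*); L²(ℝ³))} + ∫_{t₁}^{T*}∫_{ℝ³} |∇(|v|^{q/2})|² dx ds < ∞` with
  `q := 2 + C^{(0)}_univ/M`." This is the form the N0 route LebesgueExponentPincer (crux
  `SuperEnergyJaw`, `sup_t ‖u(t)‖_{L^q} < ∞` for some `q ∈ (2,3)`) cites.
* *"The pressure associated to `v`"* = the Riesz-transform pressure `−Δ⁻¹∂ᵢ∂ⱼ(vᵢvⱼ)` of the
  whole-space problem, rendered slice-wise by the tree's `rieszPressure (u t)`
  (`RieszPressureL3.lean`: the `L³ → L^{3/2}` extension of the normalised pressure, junk `0` off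
  `L³`). Under the standing hypotheses every slice `u t` with `t` outside a null set of `(0,T)` lies
  in `L² ∩ L^∞ ⊂ L³` (all slices are in `L²`, and `uncurry u` is essentially bounded on
  `(0,T') × ℝ³`), so `rieszPressure (u t)` IS the associated pressure for a.e. `t`; the bound is
  imposed at every `t ∈ (0,T)` (on the null set of possibly-junk slices this can only be vacuously
  easier, which the printed ess-sup in time ignores as well). `‖p‖_{L^{3/2,∞}} ≤ M²` is
  `eWeakLpPow p (3/2) volume ≤ (ofReal M)³` (`sup_α α^{3/2} d_p(α) ≤ (M²)^{3/2}`).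
* *Conclusion.* `|v|^{q/2} ∈ L^∞((t₁,T*); L²)` is `v ∈ L^∞((t₁,T*); L^q)`, the tree's mixed class
  `MemLqLp ∞ (ofReal q) u (Ioo t₁ T)` (as `ess_endpoint` writes `L^∞_t L³_x`); `∇(|v|^{q/2}) ∈ L²`
  is the existence of an a.e.-in-time weak gradient `H t` of the scalar slice `x ↦ |u(t,x)|^{q/2}`
  with `∫_{t₁}^{T}∫ ‖H‖² < ∞` (operator norm; any norm on `ℝ³ →L ℝ` gives the same class).
* *Viscosity.* `w(y,s) = ν⁻¹u(y,s/ν)` has pressure `ν⁻²p`, so the bound reads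
  `‖p(t)‖_{L^{3/2,∞}} ≤ ν²M²`, i.e. `eWeakLpPow (rieszPressure (u t)) (3/2) ≤ (ofReal (νM))³`; the
  conclusion classes are invariant.

## Mathlib / tree search

`lean search 'Barker2024|2111.14776|higher_integrability|card_singular'`: the key `Barker2024` was
cited only in prose (barrier `CriticalNormBlowupNecessity`, theses); no transcription (2026-08-26).
Reused: `IsGlobalLerayHopf`, `HasWeakGradient`, `frobeniusNormSq`, `MemLqLp` (`LerayHopf.lean`,
`VectorCalculus.lean`), `rieszPressure` (`RieszPressureL3.lean`), `parabolicCylinder`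
(`SuitableWeak.lean`), `FunctionSpaces.eWeakLpPow` (`WeakLp.lean`). Mathlib has no Navier–Stokes or Lorentz-space notions.

## References

* T. Barker, Proc. Amer. Math. Soc. Ser. B 11 (2024) = arXiv:2111.14776: §1.1 pp. 2–3 (Thm 1,
  Cor 1, Thm 2), §1.4 p. 5, footnotes 3–4 p. 2. [`Barker2024`]
* T. Barker, C. Prange, Comm. Math. Phys. 385 (2021), Cor. 9 (the tree's
  `barkerPrange2021_typeI_card_singular_points`). [`BarkerPrange2021`]
* H. J. Choe, J. Wolf, M. Yang, Math. Ann. 375 (2019); G. Seregin (2019) — the qualitative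
  finiteness results named in §1.2.2.
-/

noncomputable section

open MeasureTheory Set Function Metric Filter
open _root_.Topology
open scoped ENNReal

namespace Literature.Analysis.FluidPDE

/-- **Barker 2024, Corollary 1 (higher integrability of the gradient up to a first blow-up time
under a Type-I weak-`L³` bound).** There are a universal `C > 0` and a threshold `M₁` such that for
all `M ≥ M₁`, every viscosity `ν > 0` and every `T > 0`: if `u` is a global Leray–Hopf weak solution
of the unforced Navier–Stokes equations with viscosity `ν` (`IsGlobalLerayHopf ν 0 u₀ u`) which
**first blows up at `T`** — essentially bounded on `(0,T') × ℝ³` for every `T' < T`, with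
`‖u(t)‖_{L^∞} → ∞` as `t ↑ T` — and satisfies `‖u(t)‖_{L^{3,∞}} ≤ νM` for all `0 < t < T`, then for
every `t₂ ∈ (0,T)` the gradient has the higher integrability `∇u ∈ L^{2 + C/M}((t₂,T) × ℝ³)`: some
a.e.-in-time weak gradient `G` of the slices `u t` on `(t₂,T)` satisfies
`∫_{t₂}^{T} ∫ |G(t,x)|^{2 + C/M} dx dt < ∞` (`|G|² = frobeniusNormSq G`). Printed for `ν = 1`
("`∇v ∈ L^{2 + C^{(1)}_univ/M}(ℝ³ × (t₂,T*))`"); general `ν` by scaling (module docstring). [cite: Barker2024, Cor. 1 (arXiv:2111.14776 §1.1 pp. 2–3)] -/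
def barker2024_typeI_gradient_higher_integrability : Prop :=
  ∃ C : ℝ, 0 < C ∧ ∃ M₁ : ℝ, ∀ M : ℝ, M₁ ≤ M → ∀ (ν T : ℝ), 0 < ν → 0 < T →
    ∀ (u₀ : EuclideanSpace ℝ (Fin 3) → EuclideanSpace ℝ (Fin 3))
      (u : ℝ → EuclideanSpace ℝ (Fin 3) → EuclideanSpace ℝ (Fin 3)),
      IsGlobalLerayHopf ν 0 u₀ u →
      (∀ T' ∈ Ioo 0 T, eLpNorm (uncurry u) ∞ (volume.restrict (Ioo 0 T' ×ˢ univ)) < ∞) →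
      Tendsto (fun t => eLpNorm (u t) ∞ volume) (𝓝[<] T) (𝓝 ∞) →
      (∀ t ∈ Ioo 0 T,
        FunctionSpaces.eWeakLpPow (u t) 3 volume ≤ ENNReal.ofReal (ν * M) ^ (3 : ℕ)) →
      ∀ t₂ ∈ Ioo 0 T,
        ∃ G : ℝ → EuclideanSpace ℝ (Fin 3) →
            EuclideanSpace ℝ (Fin 3) →L[ℝ] EuclideanSpace ℝ (Fin 3),
          (∀ᵐ t ∂(volume.restrict (Ioo t₂ T)), HasWeakGradient (u t) (G t)) ∧
          ∫⁻ t in Ioo t₂ T, ∫⁻ x, ENNReal.ofReal (frobeniusNormSq (G t x)) ^ ((2 + C / M) / 2) < ∞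

/-- **Barker 2024, Theorem 2 (the number of singular points at a first blow-up time under a
weak-`L³` bound along a sequence of times).** There are a universal `C ≥ 1` and a threshold `M₁`
such that for all `M ≥ M₁`, every viscosity `ν > 0` and every `T > 0`: if `u` is a global Leray–Hopf
weak solution of the unforced Navier–Stokes equations with viscosity `ν` which **first blows up at
`T`** (essentially bounded on `(0,T') × ℝ³` for every `T' < T`, `‖u(t)‖_{L^∞} → ∞` as `t ↑ T`), and
along some increasing sequence of times `s_n ∈ (0,T)`, `s_n ↑ T`, the slices obey
`sup_n ‖u(·,s_n)‖_{L^{3,∞}} ≤ νM`, then the set of blow-up points at time `T` — the `x` with `u`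
essentially unbounded on every backward cylinder `(T − r², T) × B_r(x)`, `0 < r`, `r² < T` — is
contained in a finite set of cardinality `≤ C M^{20}`. Printed for `ν = 1` on `ℝ³ × (−1,∞)` with
blow-up at `0` ("`σ` has at most `C^{(2)}_univ M^{20}` elements"); general frame by scaling (module
docstring). Improves the tree's `barkerPrange2021_typeI_card_singular_points` (Type I bound at all
times, count `exp(exp(M^{1024}))`). [cite: Barker2024, Thm. 2 (arXiv:2111.14776 §1.1 p. 3)] -/
def barker2024_card_singular_points_weakL3_slices : Prop :=
  ∃ C : ℝ, 1 ≤ C ∧ ∃ M₁ : ℝ, ∀ M : ℝ, M₁ ≤ M → ∀ (ν T : ℝ), 0 < ν → 0 < T →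
    ∀ (u₀ : EuclideanSpace ℝ (Fin 3) → EuclideanSpace ℝ (Fin 3))
      (u : ℝ → EuclideanSpace ℝ (Fin 3) → EuclideanSpace ℝ (Fin 3)),
      IsGlobalLerayHopf ν 0 u₀ u →
      (∀ T' ∈ Ioo 0 T, eLpNorm (uncurry u) ∞ (volume.restrict (Ioo 0 T' ×ˢ univ)) < ∞) →
      Tendsto (fun t => eLpNorm (u t) ∞ volume) (𝓝[<] T) (𝓝 ∞) →
      ∀ s : ℕ → ℝ, StrictMono s → (∀ n, s n ∈ Ioo 0 T) → Tendsto s atTop (𝓝 T) →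
        (∀ n, FunctionSpaces.eWeakLpPow (u (s n)) 3 volume ≤ ENNReal.ofReal (ν * M) ^ (3 : ℕ)) →
        ∃ F : Finset (EuclideanSpace ℝ (Fin 3)), (F.card : ℝ) ≤ C * M ^ (20 : ℕ) ∧
          ∀ x : EuclideanSpace ℝ (Fin 3),
            (∀ r : ℝ, 0 < r → r ^ 2 < T →
              eLpNorm (uncurry u) ∞ (volume.restrict (parabolicCylinder r (T, x))) = ∞) →
            x ∈ F

/-- **Barker 2024, Theorem 1 (higher integrability of the velocity up to a first blow-up time under
a weak-`L^{3/2}` bound on the pressure).** There are a universal `C ≥ 1` and a threshold `M₁` such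
that for all `M ≥ M₁`, every viscosity `ν > 0` and every `T > 0`: if `u` is a global Leray–Hopf weak
solution of the unforced Navier–Stokes equations with viscosity `ν` which **first blows up at `T`**
(essentially bounded on `(0,T') × ℝ³` for every `T' < T`, `‖u(t)‖_{L^∞} → ∞` as `t ↑ T`), and its
associated (Riesz) pressure obeys `‖p(t)‖_{L^{3/2,∞}} ≤ ν²M²` for all `0 < t < T`
(`eWeakLpPow (rieszPressure (u t)) (3/2) ≤ (νM)³`), then with `q = 2 + C/M`, for every
`t₁ ∈ (0,T)`: `u ∈ L^∞((t₁,T); L^q)` (i.e. `|u|^{q/2} ∈ L^∞_t L²_x`) and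
`∇(|u|^{q/2}) ∈ L²((t₁,T) × ℝ³)` (some a.e.-in-time weak gradient `H` of the scalar slices
`x ↦ |u(t,x)|^{q/2}` is square integrable on the slab). Printed for `ν = 1` with
`‖p‖_{L^∞((0,T*); L^{3/2,∞})} ≤ M²`; general `ν` by `w = ν⁻¹u(·,·/ν)` (module docstring, Addendum). [cite: Barker2024, Thm. 1 (arXiv:2111.14776 §1.1 p. 2)] -/
def barker2024_higher_integrability_weak_pressure : Prop :=
  ∃ C : ℝ, 1 ≤ C ∧ ∃ M₁ : ℝ, ∀ M : ℝ, M₁ ≤ M → ∀ (ν T : ℝ), 0 < ν → 0 < T →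
    ∀ (u₀ : EuclideanSpace ℝ (Fin 3) → EuclideanSpace ℝ (Fin 3))
      (u : ℝ → EuclideanSpace ℝ (Fin 3) → EuclideanSpace ℝ (Fin 3)),
      IsGlobalLerayHopf ν 0 u₀ u →
      (∀ T' ∈ Ioo 0 T, eLpNorm (uncurry u) ∞ (volume.restrict (Ioo 0 T' ×ˢ univ)) < ∞) →
      Tendsto (fun t => eLpNorm (u t) ∞ volume) (𝓝[<] T) (𝓝 ∞) →
      (∀ t ∈ Ioo 0 T,
        FunctionSpaces.eWeakLpPow (rieszPressure (u t)) (3 / 2 : ℝ≥0∞) volume ≤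
          ENNReal.ofReal (ν * M) ^ (3 : ℕ)) →
      ∀ t₁ ∈ Ioo 0 T,
        MemLqLp ∞ (ENNReal.ofReal (2 + C / M)) u (Ioo t₁ T) ∧
        ∃ H : ℝ → EuclideanSpace ℝ (Fin 3) → EuclideanSpace ℝ (Fin 3) →L[ℝ] ℝ,
          (∀ᵐ t ∂(volume.restrict (Ioo t₁ T)),
            HasWeakGradient (fun x => ‖u t x‖ ^ ((2 + C / M) / 2)) (H t)) ∧
          ∫⁻ t in Ioo t₁ T, ∫⁻ x, ‖H t x‖ₑ ^ 2 < ∞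

end Literature.Analysis.FluidPDE

end
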